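import Summits.AnomalousDissipation.AnomalousDissipation.Theorems.BaireTransferDenseLoudDesignerForcesErgodicLinearisedH2Smoothing
import Literature.Analysis.FunctionSpaces.TorusH2BoundedH1Cauchy

/-!
# Compactness `V → V` of the linearised flow over a window on `T³` (tools stub `stub_linearisedCompactnessTools`,
# block N-C, line `ergodic-budget-selection-closing`, crux `BaireTransfer.DenseLoudDesignerForces`,
# stmt-AnomalousDissipation-1143)

Summit-side specialisation to `T³ = UnitAddTorus (Fin 3)` of the physical-space Rellich lemma
`Torus.exists_strictMono_h1Cauchy_of_integral_norm_laplacian_sq_le`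
(`Literature/Analysis/FunctionSpaces/TorusH2BoundedH1Cauchy.lean`: smooth fields bounded in `L²` with
`‖Δ·‖₂²` bounded have an `H¹`-Cauchy subsequence — Warner 1983 Lemma 6.23 on the lattice, `s = 1 < t = 2`,
transported by Parseval), fed with the two a priori bounds of the linearised Navier–Stokes flow at the final
time of the window `[a, a + τ]`:

* the exponential `H¹` bound `∫ ‖w(a + τ)‖² + ‖∇w(a + τ)‖₂² ≤ e^{K'τ} (∫ ‖w(a)‖² + ‖∇w(a)‖₂²)`
  (`Torus.linearisedNS_h1_le_mul_exp`, `Literature/Analysis/FluidPDE/TorusLinearisedNSH1Balance.lean`);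
* the `V → H²` smoothing `∫ ‖Δw(a + τ)‖² ≤ C (∫ ‖w(a)‖² + ‖∇w(a)‖₂²)` (the landed tools stub C1
  `stub_linearisedH2SmoothingTools`, `…ErgodicLinearisedH2Smoothing.lean`).

Read against the line's predicate `IsLinearizedNSSolutionOn S ν u w q` (file `…ErgodicLine.lean` §2): along a
jointly smooth divergence-free base field `u` on `[a, a + τ] × T³` with `‖u‖ ≤ M`, `‖∂ᵢu‖ ≤ Λ₁`,
`‖Δu(t)‖₂² ≤ Y₁`, every sequence of linearised solutions with `H¹`-normalised data has a subsequence whose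
final slices are Cauchy in `H¹` — the time-`τ` solution operator of the first variation equation is a COMPACT
operator `V → V` (Constantin–Foias 1988 Ch. 14 with Rellich; conjugated by the frame isometry this is
`IsCompactOperator (fderiv ℝ (g t) x)` of the smooth model, block N-C).  The registered tools stub
`stub_linearisedCompactnessTools` is proved BY NAME with exactly the registered signature.

References: F. W. Warner, *Foundations of Differentiable Manifolds and Lie Groups* (1983) Lemma 6.23;
P. Constantin, C. Foias, *Navier–Stokes Equations* (1988) Ch. 14; R. Temam, *Navier–Stokes Equations and
Nonlinear Functional Analysis* (1995) Ch. I §2.1.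
-/

-- `Summit.<Summit>.<Problem>` is the tree's mandated summit-side namespace (CONVENTIONS §2); for this
-- single-conjunct summit the two coincide, so the duplicate is deliberate.
set_option linter.dupNamespace false

noncomputable section

open scoped BigOperators Topology ENNReal InnerProductSpace
open Filter Set Function MeasureTheory

namespace Summit.AnomalousDissipation.AnomalousDissipation.Theorems.DenseLoudDesignerForces.Ergodic

open Literature.Analysis.FunctionSpaces Literature.Analysis.FunctionSpaces.Torus
open Literature.Analysis.FluidPDE Literature.Analysis.FluidPDE.Torus

/-- **Tools stub C2 of block N-C (`stub_linearisedCompactnessTools`, crux stmt-AnomalousDissipation-1143, line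
`ergodic-budget-selection-closing`) — compactness of the linearised flow `V → V` over a window.**  Along a
jointly smooth divergence-free background `u` on `[a, a + τ] × T³` (`τ > 0`, `ν > 0`) with `‖u‖ ≤ M`,
`‖∂ᵢu‖ ≤ Λ₁` and `‖Δu(t)‖₂² ≤ Y₁`, any sequence `(wₙ, qₙ)` of solutions of the linearised system
(`IsLinearizedNSSolutionOn`: smooth, divergence free, mean zero, `∂ₜw + (u·∇)w + (w·∇)u = νΔw − ∇q`) with
`H¹`-normalised data `∫ ‖wₙ(a)‖² + ‖∇wₙ(a)‖₂² ≤ 1` has a subsequence `w ∘ ψ` whose final slices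
`w_{ψn}(a + τ)` are CAUCHY in `H¹`: for every `ε > 0`,
`∫ ‖w_{ψm}(a + τ) − w_{ψn}(a + τ)‖² + ‖∇(w_{ψm}(a + τ) − w_{ψn}(a + τ))‖₂² < ε` for all large `m, n`.
Proof: at the final time `∫ ‖wₙ‖² ≤ e^{K'τ}` (`Torus.linearisedNS_h1_le_mul_exp` with `Cᵢ = Λ₁`) and
`∫ ‖Δwₙ‖² ≤ |C|` (the `V → H²` smoothing `stub_linearisedH2SmoothingTools`), so the physical-space Rellich
lemma `Torus.exists_strictMono_h1Cauchy_of_integral_norm_laplacian_sq_le` (`H² ⊂⊂ H¹` on `T^d`, Warner 1983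
Lemma 6.23 on the lattice with `s = 1 < t = 2`, Parseval) applies to the smooth slices `wₙ(a + τ)`.
[cite: WarnerGTM94, Lemma 6.23] -/
theorem stub_linearisedCompactnessTools {ν : ℝ} (hν : 0 < ν) {M Λ₁ Y₁ τ a : ℝ} (hτ : 0 < τ)
    {u : ℝ → (UnitAddTorus (Fin 3)) → (EuclideanSpace ℝ (Fin 3))} (hu : IsSmoothSpaceTimeOn (Icc a (a + τ)) u)
    (hudiv : ∀ t ∈ Icc a (a + τ), IsDivFree (u t)) (hM : ∀ t ∈ Icc a (a + τ), ∀ x, ‖u t x‖ ≤ M)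
    (hΛ : ∀ i, ∀ t ∈ Icc a (a + τ), ∀ x, ‖partialDeriv i (u t) x‖ ≤ Λ₁) (hY : ∀ t ∈ Icc a (a + τ), ∫ x, ‖laplacian (u t) x‖ ^ 2 ≤ Y₁)
    (w : ℕ → ℝ → (UnitAddTorus (Fin 3)) → (EuclideanSpace ℝ (Fin 3))) (q : ℕ → ℝ → (UnitAddTorus (Fin 3)) → ℝ)
    (hw : ∀ n, IsLinearizedNSSolutionOn (Icc a (a + τ)) ν u (w n) (q n))
    (hB : ∀ n, (∫ x, ‖w n a x‖ ^ 2) + gradNormSq (w n a) ≤ 1) :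
    ∃ ψ : ℕ → ℕ, StrictMono ψ ∧ ∀ ε : ℝ, 0 < ε → ∃ N₀ : ℕ, ∀ m n : ℕ, N₀ ≤ m → N₀ ≤ n →
      (∫ x, ‖w (ψ m) (a + τ) x - w (ψ n) (a + τ) x‖ ^ 2) + gradNormSq (w (ψ m) (a + τ) - w (ψ n) (a + τ)) < ε := by
  obtain ⟨C, hC⟩ := stub_linearisedH2SmoothingTools hν M Λ₁ Y₁ τ hτ
  have hb : a + τ ∈ Icc a (a + τ) := ⟨by linarith, le_rfl⟩
  -- the final slices are smooth
  have hsm : ∀ n, IsSmooth (w n (a + τ)) := fun n => (hw n).1.isSmooth_slice hb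
  -- `L²` bound at the final time from the exponential `H¹` bound
  have h0 : ∀ n, ∫ x, ‖w n (a + τ) x‖ ^ 2 ≤
      Real.exp ((2 * ∑ _i : Fin 3, Λ₁ + ((∑ _i : Fin 3, Λ₁) ^ 2 + (Fintype.card (Fin 3)) * M ^ 2) / ν) * τ) := by
    intro n
    have h := linearisedNS_h1_le_mul_exp hν hu hudiv (hw n).1 (hw n).2.1 (hw n).2.2.1 (hw n).2.2.2.2 hM
      (C := fun _ => Λ₁) hΛ hb
    rw [add_sub_cancel_left] at h
    calc ∫ x, ‖w n (a + τ) x‖ ^ 2 ≤ (∫ x, ‖w n (a + τ) x‖ ^ 2) + gradNormSq (w n (a + τ)) :=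
          le_add_of_nonneg_right (gradNormSq_nonneg _)
      _ ≤ ((∫ x, ‖w n a x‖ ^ 2) + gradNormSq (w n a)) *
            Real.exp ((2 * ∑ _i : Fin 3, Λ₁ + ((∑ _i : Fin 3, Λ₁) ^ 2 + (Fintype.card (Fin 3)) * M ^ 2) / ν) *
              τ) := h
      _ ≤ 1 * Real.exp ((2 * ∑ _i : Fin 3, Λ₁ + ((∑ _i : Fin 3, Λ₁) ^ 2 + (Fintype.card (Fin 3)) * M ^ 2) / ν) *
            τ) := mul_le_mul_of_nonneg_right (hB n) (Real.exp_nonneg _)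
      _ = _ := one_mul _
  -- `‖Δ·‖₂²` bound at the final time from the `V → H²` smoothing
  have h2 : ∀ n, ∫ x, ‖laplacian (w n (a + τ)) x‖ ^ 2 ≤ |C| := by
    intro n
    have hX0 : 0 ≤ (∫ x, ‖w n a x‖ ^ 2) + gradNormSq (w n a) :=
      add_nonneg (integral_nonneg fun _ => sq_nonneg _) (gradNormSq_nonneg _)
    calc ∫ x, ‖laplacian (w n (a + τ)) x‖ ^ 2 ≤ C * ((∫ x, ‖w n a x‖ ^ 2) + gradNormSq (w n a)) :=
          hC hu hudiv hM hΛ hY (hw n)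
      _ ≤ |C| * ((∫ x, ‖w n a x‖ ^ 2) + gradNormSq (w n a)) :=
          mul_le_mul_of_nonneg_right (le_abs_self C) hX0
      _ ≤ |C| * 1 := mul_le_mul_of_nonneg_left (hB n) (abs_nonneg C)
      _ = |C| := mul_one _
  exact exists_strictMono_h1Cauchy_of_integral_norm_laplacian_sq_le (v := fun n => w n (a + τ)) hsm h0 h2

end Summit.AnomalousDissipation.AnomalousDissipation.Theorems.DenseLoudDesignerForces.Ergodic

end
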